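import Literature.Geometry.Lorentzian.GlobalHyperbolicityStrongCausalityProofs
import Literature.Geometry.Lorentzian.MinkowskiGlobalHyperbolicity
import Summits.FinalStateConjecture.FinalStateConjecture.Theorems.EIHFluxBalanceInertialRecessionNoHoles

/-!
# Route EIHFluxBalance — `InertialRecession`, re-charting: causal bookkeeping kit

Helper file for the crux `stmt-FinalStateConjecture-10166`
(`Summit.FinalStateConjecture.FinalStateConjecture.Theses.EIHFluxBalance.InertialRecession`),
stub `stub_rechart` (the transfer P2 of line `sublinear-is-free-clean-window-charges`).

The causal clauses of the sought `FinalStateDecomposition` (`diff_subset_causalPast`, clause (ii)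
of `HasExhaustiveCharts`) are transported from the hypothesis' lab-slab exhaustion clause along
explicit causal curves. This file collects the soft causal-theoretic bookkeeping used there, for a
general time-oriented Lorentzian manifold without boundary:

* `causalPast_causalPast_eq` — `J⁻(J⁻ S) = J⁻ S` (time dual of the landed
  `LorentzianMetric.causalFuture_causalFuture_eq`); `mem_causalPast_of_subset_causalPast`;
* `mem_causalPast_singleton_of_curve` / `mem_causalPast_of_curve` — an initial point of a future
  causal curve lies in the causal past of every later point of the curve (time dual of the landed
  `IsFutureCausalCurveOn.apply_mem_causalFuture_apply_left`);
* `subset_chronologicalPast_of_subset_isOpen` — a subset of an open set `W` lies in `I⁻(W)`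
  (from the landed `subset_chronologicalPast_of_isOpen`), and `I⁻ ⊆ J⁻`;
* `exists_mem_Icc_apply_eq_of_curve` — the intermediate value theorem for a continuous function
  read, through an open embedding `e : X → M`, along a curve running inside `range e` (used to hit
  a hole-chart time level exactly along a loitering curve).

[O'Neill 1983, Ch. 14, pp. 402–404; folklore]
-/

noncomputable section

set_option linter.dupNamespace false

open Set Filter Topology Function Literature.Geometry.Lorentzian
open scoped Manifold

namespace Summit.FinalStateConjecture.FinalStateConjecture.Theorems

section Causal

variable {E : Type*} [NormedAddCommGroup E] [NormedSpace ℝ E] {H : Type*} [TopologicalSpace H]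
  {I : ModelWithCorners ℝ E H} {n : WithTop ℕ∞} {M : Type*} [TopologicalSpace M]
  [ChartedSpace H M] [IsManifold I ((⊤ : ℕ∞) : WithTop ℕ∞) M]
  {g : LorentzianMetric I n M} {τ : TimeOrientation g}

/-- **`J⁻(J⁻ S) = J⁻ S`** on a manifold without boundary, for a `C²` metric: the time dual of
`LorentzianMetric.causalFuture_causalFuture_eq`. O'Neill 1983, Ch. 14, p. 403. [folklore] -/
theorem causalPast_causalPast_eq [BoundarylessManifold I M] (hn : 2 ≤ n) (S : Set M) :
    g.causalPast τ (g.causalPast τ S) = g.causalPast τ S :=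
  LorentzianMetric.causalFuture_causalFuture_eq (τ := τ.reverse) hn S

/-- Transitivity of `J⁻` in the form used by the transfer: if `p ∈ J⁻(T)` and `T ⊆ J⁻(S)` then
`p ∈ J⁻(S)`. O'Neill 1983, Ch. 14, p. 402. [folklore] -/
theorem mem_causalPast_of_subset_causalPast [BoundarylessManifold I M] (hn : 2 ≤ n)
    {S T : Set M} {p : M} (hp : p ∈ g.causalPast τ T) (hT : T ⊆ g.causalPast τ S) :
    p ∈ g.causalPast τ S := by
  rw [← causalPast_causalPast_eq hn S]
  exact LorentzianMetric.causalFuture_mono hT hp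

/-- The initial point of a future causal curve lies in the causal past of every point of the
curve. O'Neill 1983, Ch. 14, pp. 402–403. [folklore] -/
theorem mem_causalPast_singleton_of_curve {γ : ℝ → M} {a b s : ℝ}
    (hγ : g.IsFutureCausalCurveOn τ γ (Icc a b)) (hs : s ∈ Icc a b) :
    γ a ∈ g.causalPast τ {γ s} :=
  LorentzianMetric.mem_causalPast_singleton_iff.mpr (hγ.apply_mem_causalFuture_apply_left hs)

/-- The initial point of a future causal curve lies in `J⁻(S)` as soon as some point of the curve
lies in `S`. O'Neill 1983, Ch. 14, pp. 402–403. [folklore] -/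
theorem mem_causalPast_of_curve {γ : ℝ → M} {a b s : ℝ} {S : Set M}
    (hγ : g.IsFutureCausalCurveOn τ γ (Icc a b)) (hs : s ∈ Icc a b) (hS : γ s ∈ S) :
    γ a ∈ g.causalPast τ S :=
  LorentzianMetric.causalFuture_mono (singleton_subset_iff.mpr hS)
    (mem_causalPast_singleton_of_curve hγ hs)

/-- `J⁻(S) = ⋃_{q ∈ S} J⁻(q)` in membership form. O'Neill 1983, Ch. 14, p. 402. [folklore] -/
theorem mem_causalPast_iff_exists_mem {S : Set M} {p : M} :
    p ∈ g.causalPast τ S ↔ ∃ q ∈ S, p ∈ g.causalPast τ {q} := by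
  unfold LorentzianMetric.causalPast
  rw [LorentzianMetric.causalFuture_eq_biUnion]
  simp only [mem_iUnion, exists_prop]

/-- `I⁻(S) ⊆ J⁻(S)`. O'Neill 1983, Ch. 14, p. 402. [folklore] -/
theorem chronologicalPast_subset_causalPast (S : Set M) :
    g.chronologicalPast τ S ⊆ g.causalPast τ S :=
  LorentzianMetric.chronologicalFuture_subset_causalFuture g τ.reverse S

/-- A subset of an open set `W` of a spacetime without boundary lies in `I⁻(W)`.
O'Neill 1983, Ch. 14, Lemma 14.3 (p. 403). [folklore] -/
theorem subset_chronologicalPast_of_subset_isOpen [BoundarylessManifold I M] {S W : Set M}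
    (hW : IsOpen W) (hSW : S ⊆ W) : S ⊆ g.chronologicalPast τ W :=
  hSW.trans (subset_chronologicalPast_of_isOpen g τ hW)

/-- `J⁻` of a union contains `J⁻` of each part (monotonicity, left). [folklore] -/
theorem causalPast_subset_causalPast_union_left (S T : Set M) :
    g.causalPast τ S ⊆ g.causalPast τ (S ∪ T) :=
  LorentzianMetric.causalFuture_mono subset_union_left

/-- `J⁻` of a union contains `J⁻` of each part (monotonicity, right). [folklore] -/
theorem causalPast_subset_causalPast_union_right (S T : Set M) :
    g.causalPast τ T ⊆ g.causalPast τ (S ∪ T) :=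
  LorentzianMetric.causalFuture_mono subset_union_right

/-- A future causal curve is continuous on its parameter interval. O'Neill 1983, Ch. 14, p. 402.
[folklore] -/
theorem continuousOn_of_isFutureCausalCurveOn {γ : ℝ → M} {s : Set ℝ}
    (hγ : g.IsFutureCausalCurveOn τ γ s) : ContinuousOn γ s :=
  fun _ ht ↦ (hγ.continuousAt ht).continuousWithinAt

end Causal

/-! ### The intermediate value theorem along a curve, read through an open embedding -/

section IVT

variable {X Y : Type*} [TopologicalSpace X] [TopologicalSpace Y]

/-- **Intermediate values along a curve through an open embedding.** Let `e : X → Y` be an open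
embedding, `γ` a curve continuous on `[a, b]` with `γ([a, b]) ⊆ range e`, and `f : X → ℝ`
continuous. If `γ a = e xa`, `γ b = e xb` and `f xa ≤ c ≤ f xb`, then `f x = c` for some
`x` with `e x = γ s`, `s ∈ [a, b]` (apply the intermediate value theorem to `f ∘ e⁻¹ ∘ γ`,
`e⁻¹` being continuous on `range e`). [folklore] -/
theorem exists_mem_Icc_apply_eq_of_curve {e : X → Y} (he : IsOpenEmbedding e) {γ : ℝ → Y}
    {a b : ℝ} (hab : a ≤ b) (hγc : ContinuousOn γ (Icc a b))
    (hγr : MapsTo γ (Icc a b) (range e)) {f : X → ℝ} (hf : Continuous f) {xa xb : X}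
    (ha : e xa = γ a) (hb : e xb = γ b) {c : ℝ} (hca : f xa ≤ c) (hcb : c ≤ f xb) :
    ∃ s ∈ Icc a b, ∃ x : X, e x = γ s ∧ f x = c := by
  haveI : Nonempty X := ⟨xa⟩
  set φ := he.toOpenPartialHomeomorph e with hφ
  have hsymm : ContinuousOn φ.symm (range e) := by
    have h := φ.continuousOn_symm
    rw [hφ, he.toOpenPartialHomeomorph_target] at h
    exact h
  have hG : ContinuousOn (fun s ↦ f (φ.symm (γ s))) (Icc a b) :=
    hf.comp_continuousOn (hsymm.comp hγc hγr)
  have hGa : f (φ.symm (γ a)) = f xa := by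
    rw [← ha, hφ, he.toOpenPartialHomeomorph_left_inv]
  have hGb : f (φ.symm (γ b)) = f xb := by
    rw [← hb, hφ, he.toOpenPartialHomeomorph_left_inv]
  obtain ⟨s, hs, hsc⟩ := intermediate_value_Icc hab hG ⟨hGa ▸ hca, hGb ▸ hcb⟩
  refine ⟨s, hs, φ.symm (γ s), ?_, hsc⟩
  rw [hφ]
  exact he.toOpenPartialHomeomorph_right_inv e (hγr hs)

/-- Variant of `exists_mem_Icc_apply_eq_of_curve` with the inequalities reversed
(`f xb ≤ c ≤ f xa`). [folklore] -/
theorem exists_mem_Icc_apply_eq_of_curve' {e : X → Y} (he : IsOpenEmbedding e) {γ : ℝ → Y}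
    {a b : ℝ} (hab : a ≤ b) (hγc : ContinuousOn γ (Icc a b))
    (hγr : MapsTo γ (Icc a b) (range e)) {f : X → ℝ} (hf : Continuous f) {xa xb : X}
    (ha : e xa = γ a) (hb : e xb = γ b) {c : ℝ} (hca : c ≤ f xa) (hcb : f xb ≤ c) :
    ∃ s ∈ Icc a b, ∃ x : X, e x = γ s ∧ f x = c := by
  obtain ⟨s, hs, x, hx, hfx⟩ := exists_mem_Icc_apply_eq_of_curve he hab hγc hγr
    (f := fun x ↦ -f x) hf.neg ha hb (c := -c) (by linarith) (by linarith)
  exact ⟨s, hs, x, hx, by linarith⟩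

/-- Registered one-line form (stub `ivt_along_curve_of_isOpenEmbedding` of the crux item) of
`exists_mem_Icc_apply_eq_of_curve`. [folklore] -/
theorem ivt_along_curve_of_isOpenEmbedding : open Set Topology in ∀ {X Y : Type*} [TopologicalSpace X] [TopologicalSpace Y] {e : X → Y}, IsOpenEmbedding e → ∀ {γ : ℝ → Y} {a b : ℝ}, a ≤ b → ContinuousOn γ (Icc a b) → MapsTo γ (Icc a b) (range e) → ∀ {f : X → ℝ}, Continuous f → ∀ {xa xb : X}, e xa = γ a → e xb = γ b → ∀ {c : ℝ}, f xa ≤ c → c ≤ f xb → ∃ s ∈ Icc a b, ∃ x : X, e x = γ s ∧ f x = c :=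
  fun he _ _ _ hab hγc hγr _ hf _ _ ha hb _ hca hcb ↦
    exists_mem_Icc_apply_eq_of_curve he hab hγc hγr hf ha hb hca hcb

end IVT

end Summit.FinalStateConjecture.FinalStateConjecture.Theorems

end
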